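import Summits.BirchSwinnertonDyer.Rank1Residual.P2.TransportAtTwoShuZhai
import Summits.BirchSwinnertonDyer.BirchSwinnertonDyer.Theorems.Rank2ObservatoryRank3WitnessT3
import Summits.BirchSwinnertonDyer.BirchSwinnertonDyer.Theorems.KatoDescentPotSupersingularConductorBoundOfBadPrimes
import Literature.NumberTheory.EllipticCurves.IsogenyTwoTorsionProofs
import Literature.NumberTheory.EllipticCurves.ComplexMultiplicationHasCMProofs
import Literature.NumberTheory.EllipticCurves.HeegnerPointsTrustBaseProofs
import Literature.NumberTheory.EllipticCurves.HeegnerHypothesisKroneckerProofs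
import Literature.NumberTheory.EllipticCurves.AgasheRibetStein2006.ManinConstantOptimalCurves
import HarnessLib

/-!
# Cell `bsd-print-cf2` (D-0131 (2) PRINT TIER, leaf CornerF @ `p = 2`), prover p3 — file 1/3 (sub-lane «bsd-p2» directory, next to
# `P2/TransportAtTwoShuZhai.lean` which it instantiates): the curve
# `36a1` in the SETTING of Shu–Zhai 2021 Thm 1.2, every kernel-checkable hypothesis DISCHARGED

HONEST FRAMING. Companion of `P2/ShuZhaiThirtySixSlices.lean` (file 2/2: the BY-NAME SLICE of the W-ALL
leaf `Summit.BirchSwinnertonDyer.WAllCornerFTwo` given by the Shu–Zhai 2021 quadratic-twist family of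
`36a1`; HONEST FRAMING there). The leaf (every CM curve of analytic rank one satisfies `BSD(E,2)`) is OPEN
AS A CLASS; nothing class-wide is closed; no named fact is introduced; nothing is asserted beyond kernel
theorems about ONE explicit curve. Source of the setting: Shu–Zhai, J. reine angew. Math. 775 (2021),
§1 (Thm 1.2, Def 1.1, (Tor)) and §5.2 Table, row `36a1` ("E/ℚ satisfying f([0]) ∉ 2E(ℚ) and Condition
(Tor)": `ℚ(E[2]) = ℚ(√−3)`, `ℚ(E′[2]) = ℚ(√3)`, admissible `q = 5, 17, 29, 41, …` (`q ≡ 5 (mod 12)`),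
`p = 23, 47, 71, 167, …` (`p ≡ 23 (mod 24)`)), typed verbatim by «bsd-p2» as
`ShuZhai2021.Thm12Setting` (`Literature/…/ShuZhai2021/GeneralizedBirchLemma.lean`).

DISCHARGED IN THE KERNEL here, for the two-torsion normal form `E : y² = x³ − 3x² + 3x` of `36a1`
(Cremona's `[0,0,0,0,1]` shifted by `x ↦ x − 1`, same discriminant `−2⁴·3³`): `E` elliptic, globally
minimal (Silverman VII.1.1), `j = 0` hence CM (tree `hasCM_of_j_eq_zero`); the rational `2`-isogeny
`E → E′ = E/E[2](ℚ)`, `E′ : y² = x³ + 6x² − 3x`, of degree `2` (Silverman III.4.5; the tree's PROVED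
`twoIsogeny`); (Tor) `#E(ℚ)[2] = 2 = #E′(ℚ)[2]` (reduction modulo the good prime `5`, tree
`Rank2Observatory.twoTorsion_eq_zero_or_eq`); `N_E ∣ 432` (Ogg, tree `conductorNorm_dvd_of_localBounds`);
`d_{ℚ(√−p)} = −p` and "every prime of `N` (resp. `2N`) splits in `ℚ(√−p)`" for `p ≡ 23 (mod 24)`
(decomposition law, tree `satisfiesHeegnerHypothesis_iff_kronecker`); and the assembled
`Thm12Setting E Dt E′ p Q` modulo the two DISPLAY hypotheses on the optimal parametrisation
(`IsOptimalDatum`, `f([0]) ∉ 2E(ℚ)`) and the admissibility of `Q`, kept as printed.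

References: [ShuZhai2021] §1, §5.2 Table row 36a1 (arXiv:2102.11808 chunks p0003, p0014 L87);
[SilvermanAEC2009] III.4 Ex 4.5, VII.1 Rem 1.1, VII.3.1(b); [Silverman1994] IV.11.1; [Cremona1997]
Table 1 (36a); [Marcus1977] Ch. 2 Thm 1, Ch. 3 Thm 25.
-/

noncomputable section

open scoped Classical

open WeierstrassCurve NumberField Literature.NumberTheory.EllipticCurves
  Literature.NumberTheory.EllipticCurves.Rank1Residual
  Literature.NumberTheory.EllipticCurves.ModularForms
  Literature.NumberTheory.EllipticCurves.ShuZhai2021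
  Literature.NumberTheory.EllipticCurves.Rank1Residual.X11RankOneCertificates
  Summit.BirchSwinnertonDyer.Rank1Residual
  Summit.BirchSwinnertonDyer.BirchSwinnertonDyer.Theorems.ConductorBoundOfBadPrimes

set_option autoImplicit false

namespace Summit.BirchSwinnertonDyer.Rank1Residual.P2

/-! ## §1 The curve `36a1` in two-torsion normal form, and its `2`-isogenous curve -/

/-- **`36a1` in two-torsion normal form**: `E : y² = x³ − 3x² + 3x = x·(x² − 3x + 3)`, i.e. Cremona's
`36a1 = [0,0,0,0,1]` (`y² = X³ + 1`) with `X = x − 1`; `Δ = −432 = −2⁴·3³`, `c₄ = 0` (`j = 0`, CM by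
`ℤ[ζ₃]`), rational `2`-torsion point `T = (0,0)`. [cite: Cremona1997, Table 1 (curve 36a1)] -/
def curve36a1 : WeierstrassCurve ℚ := ⟨0, -3, 0, 3, 0⟩

/-- The same equation over `ℤ` (for reduction modulo primes). [cite: Cremona1997, Table 1 (curve 36a1)] -/
def curve36a1Int : WeierstrassCurve ℤ := ⟨0, -3, 0, 3, 0⟩

/-- **`E′ = E/E[2](ℚ)`**: the `2`-isogenous curve `y² = x³ + 6x² − 3x` (Silverman III.4.5:
`Y² = X³ − 2aX² + (a² − 4b)X` for `a = −3`, `b = 3`); `ℚ(E′[2]) = ℚ(√48) = ℚ(√3)`.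
[cite: SilvermanAEC2009, III.4 Example 4.5] -/
def curve36a1' : WeierstrassCurve ℚ := ⟨0, 6, 0, -3, 0⟩

/-- The equation of `E′` over `ℤ`. [cite: SilvermanAEC2009, III.4 Example 4.5] -/
def curve36a1'Int : WeierstrassCurve ℤ := ⟨0, 6, 0, -3, 0⟩

/-- `E` is the base change of its integer equation. [folklore] -/
theorem curve36a1Int_map : curve36a1Int.map (Int.castRingHom ℚ) = curve36a1 := by
  ext <;> simp [curve36a1Int, curve36a1, WeierstrassCurve.map]

/-- `E′` is the base change of its integer equation. [folklore] -/
theorem curve36a1'Int_map : curve36a1'Int.map (Int.castRingHom ℚ) = curve36a1' := by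
  ext <;> simp [curve36a1'Int, curve36a1', WeierstrassCurve.map]

/-- The shift `x ↦ x − 1` (`u = 1`, `r = 1`) carries `E` to Cremona's equation `y² = x³ + 1` of `36a1`.
[cite: Cremona1997, Table 1 (curve 36a1)] -/
theorem smul_curve36a1_eq_cremona : (⟨1, 1, 0, 0⟩ : VariableChange ℚ) • curve36a1 = ⟨0, 0, 0, 0, 1⟩ := by
  ext <;> simp only [curve36a1, variableChange_a₁, variableChange_a₂, variableChange_a₃, variableChange_a₄,
    variableChange_a₆, inv_one, Units.val_one] <;> norm_num

/-- `Δ(E) = −432 = −2⁴·3³`. [folklore] -/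
theorem curve36a1_Δ : curve36a1.Δ = -432 := by
  simp only [curve36a1, WeierstrassCurve.Δ, WeierstrassCurve.b₂, WeierstrassCurve.b₄, WeierstrassCurve.b₆,
    WeierstrassCurve.b₈]
  norm_num

/-- `c₄(E) = 0` (so `j(E) = 0`). [folklore] -/
theorem curve36a1_c₄ : curve36a1.c₄ = 0 := by
  simp only [curve36a1, WeierstrassCurve.c₄, WeierstrassCurve.b₂, WeierstrassCurve.b₄]
  norm_num

/-- `E` is an elliptic curve (`Δ ≠ 0`). [folklore] -/
instance isElliptic_curve36a1 : curve36a1.IsElliptic :=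
  X11b.isElliptic_of_discOf_ne_zero 0 (-3) 0 3 0 (by decide +kernel)

/-- `E′` is an elliptic curve (`Δ′ = 6912 = 2⁸·3³ ≠ 0`). [folklore] -/
instance isElliptic_curve36a1' : curve36a1'.IsElliptic :=
  X11b.isElliptic_of_discOf_ne_zero 0 6 0 (-3) 0 (by decide +kernel)

/-- **`E = [0,−3,0,3,0]` is globally minimal** (`|Δ| = 2⁴·3³`: Silverman's `q¹² ∤ Δ` at every prime).
[cite: SilvermanAEC2009, VII.1 Remark 1.1] -/
instance isGloballyMinimal_curve36a1 : curve36a1.IsGloballyMinimal :=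
  X11b.isGloballyMinimal_of_krausCriterion_support 0 (-3) 0 3 0 [(2, 2, 4), (3, 2, 3)]
    (by intro t ht; simp only [List.mem_cons, List.not_mem_nil, or_false] at ht; rcases ht with rfl | rfl <;> norm_num)
    (by decide +kernel) (by decide +kernel)

/-- `E` is in two-torsion normal form (`a₁ = a₃ = a₆ = 0`). [folklore] -/
instance isTwoTorsionNF_curve36a1 : curve36a1.IsTwoTorsionNF := ⟨rfl, rfl, rfl⟩

/-- `j(E) = 0`. [folklore] -/
theorem curve36a1_j : curve36a1.j = 0 := by
  rw [WeierstrassCurve.j, curve36a1_c₄]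
  simp

/-- **`E` has complex multiplication** (`j = 0`: CM by `ℤ[ζ₃]`, tree `hasCM_of_j_eq_zero`).
[cite: SilvermanAEC2009, Appendix C §11, Example 11.3.1] -/
theorem hasCM_curve36a1 : curve36a1.HasCM :=
  hasCM_of_j_eq_zero _ curve36a1_j

/-- Vélu's codomain of the explicit `2`-isogeny of `E` is `E′`. [cite: SilvermanAEC2009, III.4 Example 4.5] -/
theorem twoIsogenyCodomain_curve36a1 : curve36a1.twoIsogenyCodomain = curve36a1' := by
  ext <;> simp [WeierstrassCurve.twoIsogenyCodomain, curve36a1, curve36a1'] <;> norm_num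

/-- **A rational `2`-isogeny `E → E′` of degree `2`** (the tree's PROVED `twoIsogeny`, kernel `{O, T}`).
[cite: SilvermanAEC2009, III.4 Example 4.5] -/
theorem exists_isogeny_curve36a1_degree_two : ∃ φ : Isogeny curve36a1 curve36a1', φ.degree = 2 := by
  rw [← twoIsogenyCodomain_curve36a1]
  exact ⟨curve36a1.twoIsogeny, degree_twoIsogeny curve36a1⟩

/-! ## §2 (Tor): `#E(ℚ)[2] = 2 = #E′(ℚ)[2]`, by reduction modulo `5` -/

/-- In a group whose `2`-torsion is `{0, T}` with `T ≠ 0`, `2•T = 0`, the `2`-torsion subtype has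
exactly two elements. [folklore] -/
private theorem natCard_twoTorsion_eq_two {A : Type*} [AddCommGroup A] {T : A} (hT0 : T ≠ 0)
    (hT2 : (2 : ℕ) • T = 0) (h : ∀ τ : A, (2 : ℤ) • τ = 0 → τ = 0 ∨ τ = T) :
    Nat.card {P : A // (2 : ℕ) • P = 0} = 2 := by
  rw [Nat.card_eq_two_iff]
  refine ⟨⟨0, smul_zero _⟩, ⟨T, hT2⟩, fun he => hT0 (Subtype.mk.inj he).symm, ?_⟩
  ext ⟨τ, hτ⟩
  simp only [Set.mem_insert_iff, Set.mem_singleton_iff, Set.mem_univ, iff_true]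
  have hτ' : (2 : ℤ) • τ = 0 := by rw [← natCast_zsmul] at hτ; exact_mod_cast hτ
  rcases h τ hτ' with rfl | rfl
  · exact Or.inl rfl
  · exact Or.inr rfl

/-- **(Tor) for `E`: `#E(ℚ)[2] = 2`** — `E(ℚ)[2] = {O, (0,0)}`: modulo the good odd prime `5` the only affine
`2`-torsion point of `Ẽ(𝔽₅)` is `(0,0)` (`x² − 3x + 3` has no root mod `5`), and prime-to-`5` torsion
injects (tree `Rank2Observatory.twoTorsion_eq_zero_or_eq`). [cite: SilvermanAEC2009, Prop. VII.3.1(b)] -/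
theorem natCard_twoTorsion_curve36a1 : Nat.card {P : curve36a1.toAffine.Point // (2 : ℕ) • P = 0} = 2 := by
  rw [← curve36a1Int_map]
  haveI : Fact (Nat.Prime 5) := ⟨by norm_num⟩
  have hT : (0 : ℤ) ^ 2 + curve36a1Int.a₁ * 0 * 0 + curve36a1Int.a₃ * 0 =
      0 ^ 3 + curve36a1Int.a₂ * 0 ^ 2 + curve36a1Int.a₄ * 0 + curve36a1Int.a₆ := by
    simp [curve36a1Int]
  have hT2 : 2 * (0 : ℤ) + curve36a1Int.a₁ * 0 + curve36a1Int.a₃ = 0 := by simp [curve36a1Int]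
  have hΔ : ¬ ((5 : ℕ) : ℤ) ∣ curve36a1Int.Δ := by
    simp only [curve36a1Int, WeierstrassCurve.Δ, WeierstrassCurve.b₂, WeierstrassCurve.b₄,
      WeierstrassCurve.b₆, WeierstrassCurve.b₈]
    norm_num
  have hB : BirchSwinnertonDyer.Rank2Observatory.twoTorsionOnlyB curve36a1Int 5 0 0 = true := by
    decide +kernel
  have h := BirchSwinnertonDyer.Rank2Observatory.twoTorsion_eq_zero_or_eq curve36a1Int hT hT2 5 hΔ
    (by norm_num) hB
  haveI := BirchSwinnertonDyer.Rank2Observatory.isElliptic_rat curve36a1Int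
    (BirchSwinnertonDyer.Rank2Observatory.Δ_ne_zero_of_not_dvd curve36a1Int hΔ)
  refine natCard_twoTorsion_eq_two (Affine.Point.some_ne_zero _) ?_ h
  exact BirchSwinnertonDyer.Rank2Observatory.two_nsmul_some_eq_zero curve36a1Int
    (BirchSwinnertonDyer.Rank2Observatory.Δ_ne_zero_of_not_dvd curve36a1Int hΔ) hT hT2

/-- **(Tor) for `E′`: `#E′(ℚ)[2] = 2`** — `E′(ℚ)[2] = {O, (0,0)}` (`x² + 6x − 3` has discriminant `48`,
no root mod `5`). [cite: SilvermanAEC2009, Prop. VII.3.1(b)] -/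
theorem natCard_twoTorsion_curve36a1' : Nat.card {P : curve36a1'.toAffine.Point // (2 : ℕ) • P = 0} = 2 := by
  rw [← curve36a1'Int_map]
  haveI : Fact (Nat.Prime 5) := ⟨by norm_num⟩
  have hT : (0 : ℤ) ^ 2 + curve36a1'Int.a₁ * 0 * 0 + curve36a1'Int.a₃ * 0 =
      0 ^ 3 + curve36a1'Int.a₂ * 0 ^ 2 + curve36a1'Int.a₄ * 0 + curve36a1'Int.a₆ := by
    simp [curve36a1'Int]
  have hT2 : 2 * (0 : ℤ) + curve36a1'Int.a₁ * 0 + curve36a1'Int.a₃ = 0 := by simp [curve36a1'Int]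
  have hΔ : ¬ ((5 : ℕ) : ℤ) ∣ curve36a1'Int.Δ := by
    simp only [curve36a1'Int, WeierstrassCurve.Δ, WeierstrassCurve.b₂, WeierstrassCurve.b₄,
      WeierstrassCurve.b₆, WeierstrassCurve.b₈]
    norm_num
  have hB : BirchSwinnertonDyer.Rank2Observatory.twoTorsionOnlyB curve36a1'Int 5 0 0 = true := by
    decide +kernel
  have h := BirchSwinnertonDyer.Rank2Observatory.twoTorsion_eq_zero_or_eq curve36a1'Int hT hT2 5 hΔ
    (by norm_num) hB
  haveI := BirchSwinnertonDyer.Rank2Observatory.isElliptic_rat curve36a1'Int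
    (BirchSwinnertonDyer.Rank2Observatory.Δ_ne_zero_of_not_dvd curve36a1'Int hΔ)
  refine natCard_twoTorsion_eq_two (Affine.Point.some_ne_zero _) ?_ h
  exact BirchSwinnertonDyer.Rank2Observatory.two_nsmul_some_eq_zero curve36a1'Int
    (BirchSwinnertonDyer.Rank2Observatory.Δ_ne_zero_of_not_dvd curve36a1'Int hΔ) hT hT2

/-! ## §3 The conductor: `N_E ∣ 432`, so the primes of `N` and of `2N` are among `{2, 3}` -/

/-- **`N(E) ∣ 432 = 2⁴·3³` — IN THE KERNEL** (Ogg's `f_q ≤ ord_q Δ_min` at `q = 2, 3`, the only bad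
primes; Cremona: `N = 36` exactly, not needed). [cite: Silverman1994, IV.11.1] [cite: Cremona1997, Table 1 (36a1)] -/
theorem conductorNorm_curve36a1_dvd : curve36a1.conductorNorm ℤ ∣ 432 :=
  conductorNorm_dvd_of_localBounds 0 (-3) 0 3 0 curve36a1 rfl [(2, 4), (3, 3)]
    (by intro t ht; simp only [List.mem_cons, List.not_mem_nil, or_false] at ht; rcases ht with rfl | rfl <;> norm_num)
    (by decide +kernel) (by norm_num) (by decide +kernel)

/-- `N(E) ≠ 0` (instance used by the parametrisation datum at level `N`). [folklore] -/
instance neZero_conductorNorm_curve36a1 : NeZero (curve36a1.conductorNorm ℤ) :=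
  ⟨(curve36a1.conductorNorm_pos_holds).ne'⟩

/-! ## §4 `ℚ(√−p)` for `p ≡ 23 (mod 24)`: `d = −p`, and `2`, `3` split -/

/-- **`d_F = −p`** for a quadratic number field `F ∋ √−p`, `p ≡ 3 (mod 4)` prime: `θ = (1 + √−p)/2`
is a root of `X² − X + (p+1)/4` of discriminant `−p` (tree `isTotallyComplex_and_discr_eq_neg_of_root`).
[cite: Marcus1977, Ch. 2 Thm. 1] -/
theorem discr_eq_neg_of_sq_eq_neg_prime {F : Type} [Field F] [NumberField F] (h2 : Module.finrank ℚ F = 2)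
    {p : ℕ} (hp : p.Prime) (hp4 : p % 4 = 3) {x : F} (hx : x ^ 2 = ((-(p : ℤ) : ℤ) : F)) :
    NumberField.discr F = -(p : ℤ) := by
  obtain ⟨k, hk⟩ : ∃ k : ℤ, (p : ℤ) + 1 = 4 * k := ⟨(p + 1) / 4, by omega⟩
  have hd : (-1 : ℤ) ^ 2 - 4 * k = -(p : ℤ) := by linear_combination hk
  have hkF : ((p : ℤ) : F) + 1 = 4 * (k : F) := by exact_mod_cast congrArg (fun z : ℤ => (z : F)) hk
  have hx' : x ^ 2 = -((p : ℤ) : F) := by rw [hx]; push_cast; ring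
  have hrel : ((1 + x) / 2) ^ 2 + ((-1 : ℤ) : F) * ((1 + x) / 2) + ((k : ℤ) : F) = 0 := by
    have key : ((1 + x) / 2) ^ 2 + ((-1 : ℤ) : F) * ((1 + x) / 2) + ((k : ℤ) : F) =
        (x ^ 2 - 1 + 4 * (k : F)) / 4 := by
      push_cast
      field_simp
      ring
    rw [key, hx', ← hkF]
    ring
  exact (isTotallyComplex_and_discr_eq_neg_of_root h2 hp hd hrel).2

/-- **Every prime of `2ᵃ·3ᵇ` splits in `F = ℚ(√−p)` for `p ≡ 23 (mod 24)`**: `d_F = −p ≡ 1 (mod 8)` and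
`(−p/3) = (1/3) = 1` (decomposition law, tree `satisfiesHeegnerHypothesis_iff_kronecker`).
[cite: Marcus1977, Ch. 3 Thm. 25] -/
theorem satisfiesHeegnerHypothesis_two_pow_mul_three_pow {F : Type} [Field F] [NumberField F]
    (h2 : Module.finrank ℚ F = 2) {p : ℕ} (hp : p.Prime) (h24 : p % 24 = 23)
    {x : F} (hx : x ^ 2 = ((-(p : ℤ) : ℤ) : F)) (a b : ℕ) :
    SatisfiesHeegnerHypothesis (2 ^ a * 3 ^ b) F := by
  have hD := discr_eq_neg_of_sq_eq_neg_prime h2 hp (by omega) hx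
  rw [satisfiesHeegnerHypothesis_iff_kronecker _ F h2, hD]
  intro q hq hqN
  rcases (Nat.Prime.dvd_mul hq).mp hqN with h | h
  · obtain rfl := (Nat.prime_dvd_prime_iff_eq hq Nat.prime_two).mp (hq.dvd_of_dvd_pow h)
    exact ⟨fun _ => by omega, fun h2' => absurd rfl h2'⟩
  · obtain rfl := (Nat.prime_dvd_prime_iff_eq hq Nat.prime_three).mp (hq.dvd_of_dvd_pow h)
    refine ⟨fun h => absurd h (by norm_num), fun _ => ?_⟩
    have hmod : (-(p : ℤ)) % ((3 : ℕ) : ℤ) = 1 % ((3 : ℕ) : ℤ) := by push_cast; omega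
    rw [jacobiSym.mod_left, hmod, ← jacobiSym.mod_left, jacobiSym.one_left]

/-- **The Heegner hypothesis of Thm 1.2 for `(36a1, ℚ(√−p))`, `p ≡ 23 (mod 24)`: every prime of `N`
splits in `ℚ(√−p)`** (`N ∣ 432`). [cite: ShuZhai2021, Thm. 1.2 hypothesis and §5.2 Table row 36a1] -/
theorem allPrimesSplitInSqrt_conductorNorm_curve36a1 {p : ℕ} (hp : p.Prime) (h24 : p % 24 = 23) :
    AllPrimesSplitInSqrt (curve36a1.conductorNorm ℤ) (-(p : ℤ)) := by
  refine Or.inr fun F _ _ h2 ⟨x, hx⟩ => ?_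
  exact (satisfiesHeegnerHypothesis_two_pow_mul_three_pow h2 hp h24 hx 4 3).of_dvd
    (conductorNorm_curve36a1_dvd.trans (by norm_num))

/-- **Hypothesis (ii) of Thm 1.4 at `K`: every prime of `2N` splits in `ℚ(√−p)`**, `p ≡ 23 (mod 24)`
(`2N ∣ 864 = 2⁵·3³`). [cite: ShuZhai2021, Thm. 1.4 (ii) and §5.2 Table row 36a1] -/
theorem allPrimesSplitInSqrt_two_mul_conductorNorm_curve36a1 {p : ℕ} (hp : p.Prime) (h24 : p % 24 = 23) :
    AllPrimesSplitInSqrt (2 * curve36a1.conductorNorm ℤ) (-(p : ℤ)) := by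
  refine Or.inr fun F _ _ h2 ⟨x, hx⟩ => ?_
  exact (satisfiesHeegnerHypothesis_two_pow_mul_three_pow h2 hp h24 hx 5 3).of_dvd
    ((mul_dvd_mul_left 2 conductorNorm_curve36a1_dvd).trans (by norm_num))

/-! ## §5 The setting of Shu–Zhai Thm 1.2 at `E = 36a1` -/

/-- **The setting of Thm 1.2 for `E = 36a1`, `K = ℚ(√−p)` (`p ≡ 23 (mod 24)` prime), `Q` admissible.**
Discharged in the kernel: the degree-`2` isogeny `E → E′`, (Tor) for `E` and `E′`, `p > 3`, `p ≡ 3 (4)`,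
the Heegner hypothesis for `N`. Kept as printed (display hypotheses on the optimal parametrisation
`X₀(36) → E`, Shu–Zhai §5.2 Table row `36a1`): `IsOptimalDatum`, `f([0]) ∉ 2E(ℚ)`; and the admissibility
of the primes of `Q`. [cite: ShuZhai2021, Thm. 1.2 and §5.2 Table (row 36a1)] -/
theorem thm12Setting_curve36a1 (Dt : ModularParametrizationData curve36a1 (curve36a1.conductorNorm ℤ))
    (hopt : IsOptimalDatum curve36a1 Dt) (hcusp : CuspZeroNotInTwice curve36a1 Dt)
    {p : ℕ} (hp : p.Prime) (h24 : p % 24 = 23)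
    {Q : Finset ℕ} (hQ : ∀ q ∈ Q, IsAdmissible curve36a1 curve36a1' q ∧ q ≠ p) :
    Thm12Setting curve36a1 Dt curve36a1' p Q :=
  ⟨exists_isogeny_curve36a1_degree_two, hopt, hcusp, natCard_twoTorsion_curve36a1,
    natCard_twoTorsion_curve36a1', hp, by omega, by omega,
    allPrimesSplitInSqrt_conductorNorm_curve36a1 hp h24, hQ⟩


/-! ## §6 The Manin constant of `36a1` is odd — BY NAME (Agashe–Ribet–Stein 2006 Thm 2.6 = Cremona) -/

/-- **Hypothesis (i) of Thm 1.4 ("the Manin constant of `E` is odd") for `36a1`, BY NAME**: for any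
parametrisation datum `Dt` of `E` at level `N = N(E)` with the lattice equality (`E` optimal),
`|c| = 1` by the printed range theorem "if `E` is an optimal elliptic curve over `ℚ` with conductor at
most `130000`, then `c_E = 1`" (Agashe–Ribet–Stein 2006 Thm 2.6, Cremona; tree fact
`AgasheRibetStein2006.cremona_abs_maninConstant_eq_one_of_level_le`), since `N(E) ∣ 432`; hence
`2 ∤ c`. [cite: AgasheRibetStein2006, Thm. 2.6 (p. 619)] -/
theorem not_two_dvd_c_of_isOptimalDatum_curve36a1
    (hARS : AgasheRibetStein2006.cremona_abs_maninConstant_eq_one_of_level_le)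
    (Dt : ModularParametrizationData curve36a1 (curve36a1.conductorNorm ℤ))
    (hopt : IsOptimalDatum curve36a1 Dt) : ¬ (2 : ℤ) ∣ Dt.c := by
  have hN : curve36a1.conductorNorm ℤ ≤ 130000 :=
    (Nat.le_of_dvd (by norm_num) conductorNorm_curve36a1_dvd).trans (by norm_num)
  have h1 : |Dt.c| = 1 := hARS curve36a1 Dt hopt hN
  intro h2
  have h3 : (2 : ℤ) ∣ 1 := h1 ▸ (dvd_abs _ _).mpr h2
  omega

end Summit.BirchSwinnertonDyer.Rank1Residual.P2

end
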